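/-
Origin: expansion seat `planner-pub-hodgecm-mc-axioms-1-g14-0`, handover #W109 2026-08-20T15:53:55Z md5 7623502ce721 (PKG 450eb95b3187 → 7623502ce721; 126 l.; MECHANICAL (iib-R) rewrite v3.1 of the PKG file as it stands (39 token edits; rules R1x1+R5x1+RX[h₂]x37)) (`HOME/mc/pub-hodgecm-mc-axioms-1-g14/revendor/kit-r55/stage55/HodgeCM/Model/E2InstanceR2.lean`, md5 7623502ce721, 126 lines);
landed by the gen-22 packager (p-g22) in gate run 55 REPLACES the earlier landed copy of `HodgeCM/Model/E2InstanceR2.lean` (seat copy carried the packager Origin header of an earlier run (stripped)).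
-/
/-
E2 instance, revision 2 (node E of MODEL-DAG v0.14; expansion seat `planner-pub-hodgecm-mc-glue-1-g2-0`).
ADDITIVE LEAF over `HodgeCM/Model/E2Instance.lean`: consumes, BY NAME, the producer files that reached the package in
gate run 32 — theta-3-g2 `Model/SupplyInstance` (T3 #1) and axioms-1-g2 `Model/UniverseCM` (D3-geom (b)) — to narrow
two binders of `Model.perL_picardCM_ball`.  Nothing is asserted: every remaining input is a named binder.
-/
import Summits.HodgeConjecture.HodgeCM.Model.E2Instance
import Summits.HodgeConjecture.HodgeCM.Model.SupplyInstance_2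
import Summits.HodgeConjecture.HodgeCM.Model.UniverseCM
import Summits.HodgeConjecture.HodgeCM.PerL34.ThetaSubOfLiu_2

/-!
# E2 instance, revision 2: `supply` from line supply data, `thetaSub` from the Liu interface fact

`Model.perL_picardCM_r2` = `Model.perL_picardCM_ball` with

* the C4-supply binder `supply` DISCHARGED IN KERNEL from
  `lines : GoodCtx → sextic → Nonempty (LineSupplyData T V c 0) ∧ Nonempty (LineSupplyData T V c 1)`
  by theta-3-g2's `SupplyInstance.WeilLineData.supply` (route (E): lattice sums + character separation on the
  compact torus, KERNEL modulo the record's fields (W-wt), (W-maj), (W-rat) and the residual (W-res) =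
  `WeilLineData.Residual`, all DATA/PROPERTY fields of the binder, none a cited fact);
* the C5 binder `thetaSub` DISCHARGED IN KERNEL from M2 `pull_comp` (`Model.modelAxiomsPerL`, KERNEL), M13
  `Fact_alphaLine` (`Model.fact_alphaLine`, axioms-1-g2 D3-geom (b), KERNEL), the PRINT model fact M38
  `h31 : U.Fact_cmInflation` (Shimura 1998 §6 Thm 3; binder) and the [Liu21] interface fact restricted to good sextic
  contexts `hLiu` (= `ThetaModel.Fact_thetaAlbanese` at those contexts; binder, D3-geom (c)/(d) records N-i1 /
  N-G0-iii.6 upstream), by the argument of `ThetaModel.open_thetaSub_of_liu` (`Universe.Uiso_inflate_le`).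

Remaining binders (unchanged types): `hHR`, `h`, `emb`, `cover`, `wm`, `Theta`, `d12`, `d34`, `innerEmb`, `ball`,
`ballFacts`, `gen12`, `real34`, `occ`; new: `h31`, `hLiu`, `lines`.
-/

noncomputable section

open scoped TensorProduct InnerProductSpace

namespace HodgeCM

namespace Model

open HodgeCM.Universe (AdelicThetaCore AdelicThetaCore₀ SideData ThetaModel ModelAxiomsPerL)
open Literature.AlgebraicGeometry.HodgeTheory
open Literature.NumberTheory.Automorphic.PicardCM
open HodgeCM.CMTypeOps (inflate)
open HodgeCM.Model.SupplyInstance (LineSupplyData)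

variable (hHD : exists_isReal_hodgeModel) (hI : hodgePQ_independent_of_hodgeModel)
  (h₁ : BallQuotientUniformised)  (h₃ : CMAbelianVarietyRealised)

/-- **E2 instance, revision 2** (see the module docstring): `perL_picardCM_ball` with `supply` discharged from line
supply data (theta-3-g2 `SupplyInstance`) and `thetaSub` discharged from M2/M13 (KERNEL), M38 `h31` and the Liu
interface fact `hLiu` at good sextic contexts (the argument of `ThetaModel.open_thetaSub_of_liu`). -/
theorem perL_picardCM_r2 (hHR : BettiUniverse.HodgeRiemann20) (h : Bool)
    (emb : ∀ {L : CMField} {ι₁ : L →+* ℂ} {V : HermSpace3 L ι₁} (Γ : Level V),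
      (picardCMUniverse hHD hI h₁ h₃).CohC ((picardCMUniverse hHD hI h₁ h₃).pms L ι₁ V Γ) 2 →ₗ[ℂ]
        (V.latticeModel printFact_unitaryCompact_holds).toQuotientModel.H)
    (cover : ∀ {L : CMField} {ι₁ : L →+* ℂ} {V : HermSpace3 L ι₁} (Γ Γ' : Level V),
      Γ'.Γ ≤ Γ.Γ → (picardCMUniverse hHD hI h₁ h₃).Mor ((picardCMUniverse hHD hI h₁ h₃).pms L ι₁ V Γ')
        ((picardCMUniverse hHD hI h₁ h₃).pms L ι₁ V Γ))
    (wm : ∀ {L : CMField} {ι₁ : L →+* ℂ} (V : HermSpace3 L ι₁) (c : SeesawCtx L),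
      WeilThetaModel (V.latticeModel printFact_unitaryCompact_holds).toQuotientModel.G
        (V.latticeModel printFact_unitaryCompact_holds).toQuotientModel.Γ
        (c.D.latticeModelW printFact_unitaryCompact_holds).toQuotientModel.G
        (c.D.latticeModelW printFact_unitaryCompact_holds).toQuotientModel.Γ)
    (Theta : ∀ {L : CMField} {ι₁ : L →+* ℂ} (V : HermSpace3 L ι₁), SeesawCtx L → Fin 4 → ∀ Γ : Level V,
      Set ((picardCMUniverse hHD hI h₁ h₃).CohC ((picardCMUniverse hHD hI h₁ h₃).pms L ι₁ V Γ) 1))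
    (d12 d34 : ∀ {L : CMField}, SeesawCtx L → SideData L)
    (innerEmb : ∀ {L : CMField} {ι₁ : L →+* ℂ} (V : HermSpace3 L ι₁) (c : SeesawCtx L),
      (thetaModelOf hHD hI h₁ h₃ h emb cover wm Theta d12 d34).GoodCtx ι₁ c → Module.finrank ℚ c.K = 6 →
      (thetaModelOf hHD hI h₁ h₃ h emb cover wm Theta d12 d34).InnerEmbAt V)
    (h31 : (picardCMUniverse hHD hI h₁ h₃).Fact_cmInflation)
    (hLiu : ∀ {L : CMField} {ι₁ : L →+* ℂ} (V : HermSpace3 L ι₁) (c : SeesawCtx L),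
      (thetaModelOf hHD hI h₁ h₃ h emb cover wm Theta d12 d34).GoodCtx ι₁ c → Module.finrank ℚ c.K = 6 →
      ∀ (i : Fin 4) (Γ : Level V), ∃ (M : CMField) (k : c.K →+* M) (σ' : M →+* ℂ), σ'.comp k = c.σ ∧
        (thetaModelOf hHD hI h₁ h₃ h emb cover wm Theta d12 d34).Theta V c i Γ ⊆
          (picardCMUniverse hHD hI h₁ h₃).Uiso Γ M (inflate k (c.Ψ i)) σ')
    (ball : ∀ {L : CMField} {ι₁ : L →+* ℂ} (V : HermSpace3 L ι₁) (c : SeesawCtx L),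
      (picardCMUniverse hHD hI h₁ h₃).BallData V c)
    (ballFacts : ∀ {L : CMField} {ι₁ : L →+* ℂ} (V : HermSpace3 L ι₁) (c : SeesawCtx L),
      (thetaModelOf hHD hI h₁ h₃ h emb cover wm Theta d12 d34).GoodCtx ι₁ c → Module.finrank ℚ c.K = 6 →
      (thetaModelOf hHD hI h₁ h₃ h emb cover wm Theta d12 d34).BallFacts V c (ball V c))
    (lines : ∀ {L : CMField} {ι₁ : L →+* ℂ} (V : HermSpace3 L ι₁) (c : SeesawCtx L),
      (thetaModelOf hHD hI h₁ h₃ h emb cover wm Theta d12 d34).GoodCtx ι₁ c → Module.finrank ℚ c.K = 6 →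
      Nonempty (LineSupplyData (thetaModelOf hHD hI h₁ h₃ h emb cover wm Theta d12 d34) V c 0) ∧
        Nonempty (LineSupplyData (thetaModelOf hHD hI h₁ h₃ h emb cover wm Theta d12 d34) V c 1))
    (gen12 : ∀ {L : CMField} {ι₁ : L →+* ℂ} (V : HermSpace3 L ι₁) (c : SeesawCtx L),
      (thetaModelOf hHD hI h₁ h₃ h emb cover wm Theta d12 d34).GoodCtx ι₁ c → Module.finrank ℚ c.K = 6 →
      Nonempty ((thetaModelOf hHD hI h₁ h₃ h emb cover wm Theta d12 d34).Gen12FunBridge V c))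
    (real34 : ∀ {L : CMField} {ι₁ : L →+* ℂ} (V : HermSpace3 L ι₁) (c : SeesawCtx L),
      (thetaModelOf hHD hI h₁ h₃ h emb cover wm Theta d12 d34).GoodCtx ι₁ c → Module.finrank ℚ c.K = 6 →
      Nonempty ((thetaModelOf hHD hI h₁ h₃ h emb cover wm Theta d12 d34).Real34FunBridge V c))
    (occ : ∀ {L : CMField} {ι₁ : L →+* ℂ} (V : HermSpace3 L ι₁) (c : SeesawCtx L),
      (thetaModelOf hHD hI h₁ h₃ h emb cover wm Theta d12 d34).GoodCtx ι₁ c → Module.finrank ℚ c.K = 6 →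
      (∀ (Φ : (thetaModelOf hHD hI h₁ h₃ h emb cover wm Theta d12 d34).SK V c)
          (i : (thetaModelOf hHD hI h₁ h₃ h emb cover wm Theta d12 d34).SigIdx V c),
          (∃ v ∈ ((thetaModelOf hHD hI h₁ h₃ h emb cover wm Theta d12 d34).core V c).hatσ i,
              ((thetaModelOf hHD hI h₁ h₃ h emb cover wm Theta d12 d34).core V c).TΦ Φ v ≠ 0) →
          ((thetaModelOf hHD hI h₁ h₃ h emb cover wm Theta d12 d34).t12 V c).wOccurs i) ∧
        (∀ (Φ : (thetaModelOf hHD hI h₁ h₃ h emb cover wm Theta d12 d34).SK V c)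
          (i : (thetaModelOf hHD hI h₁ h₃ h emb cover wm Theta d12 d34).SigIdx V c),
          (∃ v ∈ ((thetaModelOf hHD hI h₁ h₃ h emb cover wm Theta d12 d34).core V c).hatσ i,
              ((thetaModelOf hHD hI h₁ h₃ h emb cover wm Theta d12 d34).core V c).TΦ Φ v ≠ 0) →
          ((thetaModelOf hHD hI h₁ h₃ h emb cover wm Theta d12 d34).t34 V c).wOccurs i)) :
    (picardCMUniverse hHD hI h₁ h₃).PerL :=
  perL_picardCM_ball hHD hI h₁ h₃ hHR h emb cover wm Theta d12 d34 innerEmb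
    (fun V c hc hK i Γ ω hω => by
      obtain ⟨M, k, σ', hσ, hsub⟩ := hLiu V c hc hK i Γ
      have hle := Universe.Uiso_inflate_le (Model.modelAxiomsPerL hHD hI h₃ h₁).pull_comp
        (Model.fact_alphaLine (hHD := hHD) (hI := hI) (h₁ := h₁) (h₃ := h₃)) h31 Γ c.K M k (c.Ψ i) σ'
        (hsub hω)
      rw [hσ] at hle
      exact hle)
    ball ballFacts
    (fun V c hc hK => by
      obtain ⟨⟨S₀⟩, ⟨S₁⟩⟩ := lines V c hc hK
      exact ⟨S₀.D.supply S₀.res, S₁.D.supply S₁.res⟩)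
    gen12 real34 occ

end Model

end HodgeCM

end
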